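import Mathlib
import Summits.NavierStokesRegularity.FluidComputer.SkewCutSchurCoercivity
import Summits.NavierStokesRegularity.FluidComputer.SkewCutGalerkinSectionGraphBound

/-!
# Skew-cut X0 certificate: the SECTION eigenpairs FROM TRANSCRIPT-SHAPED data (head sign change,
# one shell form per end, tail numbers) — generic banded real matrix, nested finite sections
(instab3 g6 — implementation 1 of the skew-cut X0 certifier, cell `ns-blowup`, 2026-08-27)

HONEST FRAMING (human rulings D-0035/D-0074): nothing here is a claim about Navier–Stokes
blow-up. WHAT THIS IS NOT: not NS evidence. MODEL-lane format bookkeeping; no certificate, printed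
number or census word is moved.

Both END-TO-END theorems of the X0 chain — implementation 2's closed-bracket
`AbcClassIIX0.isLinNSEigenvalue_of_section_eigenpairs` (instab4 g6) and the open-bracket
`SkewCutGalerkinFromResolventData` / `SkewCutGalerkinRealShell` / `AbcCrayaEnds` (profile-cert-3 g6,
instab3 g6) — take as INPUT a normalised eigenvector of EVERY finer Galerkin section
`[ℓ_i δ_ij + a_ij]_{F_n}` with eigenvalue in the bracket (`heig`, `hnorm`, `hxs`). The certificates
deliver this through instab3 g3's `SkewCutSchurCoercivity.exists_eigenvalue_of_certificate`, which is
stated for ONE real matrix re-indexed as `head ⊕ (shell ⊕ deep)`. This file is the index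
bookkeeping between the two, for a REAL banded matrix `a` on ANY index type with levels `ℓ` and three
nested finite sets `H ⊆ S₁ ⊆ F` (head cube, next cube, the section) with LOCALITY (`a` does not couple
`H` to the outside of `S₁`):

* `sectionEquiv`-free bookkeeping: the re-indexing `↥F ≃ ↥H ⊕ (↥(S₁∖H) ⊕ ↥(F∖S₁))` is built inside
  the proofs; no definition is introduced;
* `exists_section_eigenvector_of_transcripts`: from the n-INDEPENDENT transcript-shaped data at two
  ends `x₁ < x₂` — left inverses `N_e` of the head matrices `[(x_e − ℓ_j)δ_ij − a_ij]_H`, the SHELL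
  forms `μ_e |w|² ≤ Σ (x_e − ℓ_i − s) w_i² − wᵀ (C N_e B) w` on `S₁∖H` (the certifiers' (V5) test,
  `Q = −sym(C N B)`), the tail numbers `μ_e ≤ x_e − ℓ_i − s` off `S₁`, the opposite head determinant
  signs — and the SECTION PAIRING bound `uᵀ a u ≤ s |u|²`: a normalised real eigenvector of the
  section `[ℓ δ + a]_F` with eigenvalue in `(x₁, x₂)`, for EVERY finite `F ⊇ S₁`.

* `section_data_of_transcripts`: the same for a whole FAMILY of sections `F_n ⊇ S₁` at once, with
  the uniform GRAPH BOUND from band + growth + pairing (`SkewCutGalerkinSectionGraphBound`) — i.e.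
  literally the data `c, xs, hxs, heig, hnorm, hgraph` of the END-TO-END theorems; and
  `section_data_cast` — the same data cast into an `RCLike` field `𝕜` (the shape of
  `SkewCutGalerkinFromResolventData` / `SkewCutGalerkinRealShell`).

Mathlib + `SkewCutSchurCoercivity` + `SkewCutGalerkinSectionGraphBound`; no definitions. [folklore]
-/

namespace Summit.NavierStokesRegularity.FluidComputer.SkewCutGalerkinSectionData

open Matrix Finset
open scoped BigOperators

variable {ι : Type*} [DecidableEq ι]

/-! ### The section pairing bound on a Fintype re-indexing -/

/-- The section pairing bound `Σ_{i,j∈G} u_i a_ij u_j ≤ s Σ_{i∈G} u_i²` transported to any finite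
type embedded in the index set. -/
theorem pairing_of_embedding (a : ι → ι → ℝ) (s : ℝ)
    (hA : ∀ (G : Finset ι) (u : ι → ℝ), ∑ i ∈ G, ∑ j ∈ G, u i * a i j * u j ≤ s * ∑ i ∈ G, u i ^ 2)
    {κ : Type*} [Fintype κ] (emb : κ ↪ ι) (w : κ → ℝ) :
    ∑ y, ∑ y', w y * a (emb y) (emb y') * w y' ≤ s * ∑ y, w y ^ 2 := by
  classical
  -- extend `w` by zero to the index set
  let u : ι → ℝ := fun i => if h : ∃ y, emb y = i then w h.choose else 0
  have hu : ∀ y, u (emb y) = w y := by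
    intro y
    have h : ∃ y', emb y' = emb y := ⟨y, rfl⟩
    simp only [u, dif_pos h]
    congr 1
    exact emb.injective h.choose_spec
  have key := hA (Finset.univ.map emb) u
  rw [Finset.sum_map, Finset.sum_map] at key
  simp_rw [Finset.sum_map, hu] at key
  exact key

/-! ### The section eigenvector from transcript-shaped data -/

/-- **SECTION EIGENPAIRS FROM TRANSCRIPT-SHAPED DATA** (generic real banded matrix). Index set `ι`,
real first-order matrix `a`, levels `ℓ`, pairing constant `s` with the SECTION PAIRING bound `hA`;
nested finite sets `H ⊆ S₁ ⊆ F` with LOCALITY `hloc` (no coupling between `H` and the outside of `S₁`).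
Transcript-shaped data at the two ends `x₁ < x₂` (`e = 1, 2`): a left inverse `N_e` of the head
matrix `A_e = [(x_e − ℓ_j)δ_ij − a_ij]_H`; the SHELL form on `S₁ ∖ H` with constant `μ_e > 0`,
`μ_e |w|² ≤ Σ_i (x_e − ℓ_i − s) w_i² − wᵀ(C N_e B)w` (`B_ij = −a_ij`, `C_ij = −a_ij` the off-head
blocks of `x_e·1 − L`; = `λ_min(Λ − s + Q) ≥ μ_e`, `Q = −sym(C N B)`); the TAIL numbers
`μ_e ≤ x_e − ℓ_i − s` on `F ∖ S₁`; and opposite head determinant signs. CONCLUSION: a real vector `c`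
supported in `F`, normalised `Σ_F c_i² = 1`, with `ℓ_i c_i + Σ_{j∈F} a_ij c_j = x c_i` on `F` for some
`x ∈ (x₁, x₂)`. (instab3 g3 `exists_eigenvalue_of_certificate` after re-indexing
`↥F ≃ ↥H ⊕ (↥(S₁∖H) ⊕ ↥(F∖S₁))`.) -/
theorem exists_section_eigenvector_of_transcripts (a : ι → ι → ℝ) (ℓ : ι → ℝ) (s : ℝ)
    (hA : ∀ (G : Finset ι) (u : ι → ℝ), ∑ i ∈ G, ∑ j ∈ G, u i * a i j * u j ≤ s * ∑ i ∈ G, u i ^ 2)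
    (H S₁ F : Finset ι) (hHS : H ⊆ S₁) (hSF : S₁ ⊆ F)
    (hloc : ∀ i ∈ H, ∀ j ∉ S₁, a i j = 0 ∧ a j i = 0)
    {x₁ x₂ : ℝ} (hlt : x₁ < x₂)
    (N₁ N₂ : Matrix ↥H ↥H ℝ)
    (hN₁ : N₁ * (Matrix.of fun i j : ↥H => (if i = j then x₁ - ℓ j else 0) - a i j) = 1)
    (hN₂ : N₂ * (Matrix.of fun i j : ↥H => (if i = j then x₂ - ℓ j else 0) - a i j) = 1)
    {μ₁ μ₂ : ℝ} (hμ₁ : 0 < μ₁) (hμ₂ : 0 < μ₂)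
    (hX₁ : ∀ w : ↥(S₁ \ H) → ℝ, μ₁ * ∑ i, w i ^ 2 ≤ ∑ i : ↥(S₁ \ H), (x₁ - ℓ i.1 - s) * w i ^ 2 -
      w ⬝ᵥ (((Matrix.of fun (i : ↥(S₁ \ H)) (j : ↥H) => -a i j) * N₁ *
        (Matrix.of fun (i : ↥H) (j : ↥(S₁ \ H)) => -a i j)) *ᵥ w))
    (hX₂ : ∀ w : ↥(S₁ \ H) → ℝ, μ₂ * ∑ i, w i ^ 2 ≤ ∑ i : ↥(S₁ \ H), (x₂ - ℓ i.1 - s) * w i ^ 2 -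
      w ⬝ᵥ (((Matrix.of fun (i : ↥(S₁ \ H)) (j : ↥H) => -a i j) * N₂ *
        (Matrix.of fun (i : ↥H) (j : ↥(S₁ \ H)) => -a i j)) *ᵥ w))
    (hq₁ : ∀ i ∈ F, i ∉ S₁ → μ₁ ≤ x₁ - ℓ i - s) (hq₂ : ∀ i ∈ F, i ∉ S₁ → μ₂ ≤ x₂ - ℓ i - s)
    (hsign : (Matrix.of fun i j : ↥H => (if i = j then x₁ - ℓ j else 0) - a i j).det *
      (Matrix.of fun i j : ↥H => (if i = j then x₂ - ℓ j else 0) - a i j).det < 0) :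
    ∃ x ∈ Set.Ioo x₁ x₂, ∃ c : ι → ℝ, (∀ i ∉ F, c i = 0) ∧ ∑ i ∈ F, c i ^ 2 = 1 ∧
      ∀ i ∈ F, ℓ i * c i + ∑ j ∈ F, a i j * c j = x * c i := by
  classical
  have hHF : H ⊆ F := hHS.trans hSF
  -- the three blocks as types
  set P : Finset ι := S₁ \ H with hP
  set Q : Finset ι := F \ S₁ with hQ
  -- the re-indexing `↥F ≃ ↥H ⊕ (↥P ⊕ ↥Q)`
  let val : ↥H ⊕ (↥P ⊕ ↥Q) → ↥F := fun y => match y with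
    | Sum.inl i => ⟨i.1, hHF i.2⟩
    | Sum.inr (Sum.inl j) => ⟨j.1, hSF (Finset.mem_sdiff.mp j.2).1⟩
    | Sum.inr (Sum.inr k) => ⟨k.1, (Finset.mem_sdiff.mp k.2).1⟩
  let tof : ↥F → ↥H ⊕ (↥P ⊕ ↥Q) := fun i =>
    if h : i.1 ∈ H then Sum.inl ⟨i.1, h⟩
    else if h' : i.1 ∈ S₁ then Sum.inr (Sum.inl ⟨i.1, Finset.mem_sdiff.mpr ⟨h', h⟩⟩)
    else Sum.inr (Sum.inr ⟨i.1, Finset.mem_sdiff.mpr ⟨i.2, h'⟩⟩)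
  have hval1 : ∀ i : ↥H, (val (Sum.inl i)).1 = i.1 := fun _ => rfl
  have hval2 : ∀ j : ↥P, (val (Sum.inr (Sum.inl j))).1 = j.1 := fun _ => rfl
  have hval3 : ∀ k : ↥Q, (val (Sum.inr (Sum.inr k))).1 = k.1 := fun _ => rfl
  have hleft : Function.LeftInverse val tof := by
    intro i
    by_cases h : i.1 ∈ H
    · simp only [tof, dif_pos h]; rfl
    · by_cases h' : i.1 ∈ S₁
      · simp only [tof, dif_neg h, dif_pos h']; rfl
      · simp only [tof, dif_neg h, dif_neg h']; rfl
  have hright : Function.RightInverse val tof := by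
    rintro (i | j | k)
    · simp only [tof, val, dif_pos i.2]
    · have hj := Finset.mem_sdiff.mp j.2
      simp only [tof, val, dif_neg hj.2, dif_pos hj.1]
    · have hk := Finset.mem_sdiff.mp k.2
      have hkH : k.1 ∉ H := fun h => hk.2 (hHS h)
      simp only [tof, val, dif_neg hkH, dif_neg hk.2]
  let e : ↥F ≃ ↥H ⊕ (↥P ⊕ ↥Q) := ⟨tof, val, hleft, hright⟩
  have hesymm : ∀ y, e.symm y = val y := fun y => rfl
  -- the section matrix
  let L : Matrix ↥F ↥F ℝ := Matrix.of fun i j : ↥F => (if i = j then ℓ j else 0) + a i j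
  -- entries of `x·1 − L` in the new coordinates
  have hM : ∀ (x : ℝ) (y y' : ↥H ⊕ (↥P ⊕ ↥Q)),
      Matrix.reindex e e (x • (1 : Matrix ↥F ↥F ℝ) - L) y y' =
        (if y = y' then x - ℓ (val y').1 else 0) - a (val y).1 (val y').1 := by
    intro x y y'
    rw [Matrix.reindex_apply, Matrix.submatrix_apply, hesymm, hesymm, Matrix.sub_apply,
      Matrix.smul_apply, Matrix.one_apply]
    simp only [L, Matrix.of_apply, smul_eq_mul, mul_ite, mul_one, mul_zero]
    have hinj : val y = val y' ↔ y = y' := e.symm.injective.eq_iff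
    by_cases h : y = y'
    · subst h; simp; ring
    · have h2 : val y ≠ val y' := fun hh => h (hinj.mp hh)
      simp [h, h2]
  -- the blocks of `x·1 − L` in the new coordinates
  set hd : ℝ → Matrix ↥H ↥H ℝ := fun x => Matrix.of fun i j : ↥H => (if i = j then x - ℓ j else 0) - a i j
    with hhd
  set B' : Matrix ↥H ↥P ℝ := Matrix.of fun (i : ↥H) (j : ↥P) => -a i j with hB'
  set C' : Matrix ↥P ↥H ℝ := Matrix.of fun (i : ↥P) (j : ↥H) => -a i j with hC'
  have h11 : ∀ x : ℝ, (Matrix.reindex e e (x • (1 : Matrix ↥F ↥F ℝ) - L)).toBlocks₁₁ = hd x := by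
    intro x; ext i j
    rw [Matrix.toBlocks₁₁, Matrix.of_apply, hM]
    simp only [hhd, Matrix.of_apply, hval1]
    by_cases hij : i = j
    · subst hij; simp
    · have : (Sum.inl i : ↥H ⊕ (↥P ⊕ ↥Q)) ≠ Sum.inl j := fun hh => hij (Sum.inl.inj hh)
      simp [hij, this]
  have h12 : ∀ x : ℝ, (Matrix.reindex e e (x • (1 : Matrix ↥F ↥F ℝ) - L)).toBlocks₁₂ =
      Matrix.fromCols B' (0 : Matrix ↥H ↥Q ℝ) := by
    intro x
    rw [← Matrix.fromCols_toCols ((Matrix.reindex e e (x • (1 : Matrix ↥F ↥F ℝ) - L)).toBlocks₁₂)]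
    congr 1
    · ext i j
      rw [Matrix.toCols₁, Matrix.of_apply, Matrix.toBlocks₁₂, Matrix.of_apply, hM]
      simp [hB', hval1, hval2]
    · ext i k
      rw [Matrix.toCols₂, Matrix.of_apply, Matrix.toBlocks₁₂, Matrix.of_apply, hM, Matrix.zero_apply]
      have hk := Finset.mem_sdiff.mp k.2
      simp [hval1, hval3, (hloc i.1 i.2 k.1 hk.2).1]
  have h21 : ∀ x : ℝ, (Matrix.reindex e e (x • (1 : Matrix ↥F ↥F ℝ) - L)).toBlocks₂₁ =
      Matrix.fromRows C' (0 : Matrix ↥Q ↥H ℝ) := by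
    intro x
    rw [← Matrix.fromRows_toRows ((Matrix.reindex e e (x • (1 : Matrix ↥F ↥F ℝ) - L)).toBlocks₂₁)]
    congr 1
    · ext i j
      rw [Matrix.toRows₁, Matrix.of_apply, Matrix.toBlocks₂₁, Matrix.of_apply, hM]
      simp [hC', hval1, hval2]
    · ext k j
      rw [Matrix.toRows₂, Matrix.of_apply, Matrix.toBlocks₂₁, Matrix.of_apply, hM, Matrix.zero_apply]
      have hk := Finset.mem_sdiff.mp k.2
      simp [hval1, hval3, (hloc j.1 j.2 k.1 hk.2).2]
  have hL : ∀ x : ℝ, Matrix.reindex e e (x • (1 : Matrix ↥F ↥F ℝ) - L) =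
      Matrix.fromBlocks (hd x) (Matrix.fromCols B' (0 : Matrix ↥H ↥Q ℝ))
        (Matrix.fromRows C' (0 : Matrix ↥Q ↥H ℝ))
        ((Matrix.reindex e e (x • (1 : Matrix ↥F ↥F ℝ) - L)).toBlocks₂₂) := by
    intro x
    conv_lhs => rw [← Matrix.fromBlocks_toBlocks (Matrix.reindex e e (x • (1 : Matrix ↥F ↥F ℝ) - L))]
    rw [h11, h12, h21]
  -- the tail quadratic form (F1)+(F2): pairing bound on the tail block
  let emb : ↥P ⊕ ↥Q ↪ ι := ⟨fun y => (val (Sum.inr y)).1,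
    fun y y' h => Sum.inr.inj (e.symm.injective (Subtype.ext h))⟩
  have hemb : ∀ y, emb y = (val (Sum.inr y)).1 := fun _ => rfl
  have hD : ∀ (x : ℝ) (v : ↥P ⊕ ↥Q → ℝ),
      ∑ y, (x - ℓ (val (Sum.inr y)).1) * v y ^ 2 - s * (v ⬝ᵥ v) ≤
        v ⬝ᵥ ((Matrix.reindex e e (x • (1 : Matrix ↥F ↥F ℝ) - L)).toBlocks₂₂ *ᵥ v) := by
    intro x v
    have hpair := pairing_of_embedding a s hA emb v
    simp_rw [hemb] at hpair
    have hexp : v ⬝ᵥ ((Matrix.reindex e e (x • (1 : Matrix ↥F ↥F ℝ) - L)).toBlocks₂₂ *ᵥ v) =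
        ∑ y, (x - ℓ (val (Sum.inr y)).1) * v y ^ 2 -
          ∑ y, ∑ y', v y * a (val (Sum.inr y)).1 (val (Sum.inr y')).1 * v y' := by
      rw [dotProduct, ← Finset.sum_sub_distrib]
      refine Finset.sum_congr rfl fun y _ => ?_
      have hrow : ∑ y', (Matrix.reindex e e (x • (1 : Matrix ↥F ↥F ℝ) - L)).toBlocks₂₂ y y' * v y' =
          (x - ℓ (val (Sum.inr y)).1) * v y - ∑ y', a (val (Sum.inr y)).1 (val (Sum.inr y')).1 * v y' := by
        have hent : ∀ y', (Matrix.reindex e e (x • (1 : Matrix ↥F ↥F ℝ) - L)).toBlocks₂₂ y y' =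
            (if y = y' then x - ℓ (val (Sum.inr y')).1 else 0) - a (val (Sum.inr y)).1 (val (Sum.inr y')).1 := by
          intro y'
          rw [Matrix.toBlocks₂₂, Matrix.of_apply, hM]
          simp only [Sum.inr.injEq]
        simp_rw [hent, sub_mul, Finset.sum_sub_distrib, ite_mul, zero_mul]
        rw [Finset.sum_ite_eq Finset.univ y]
        simp only [Finset.mem_univ, if_true]
        ring
      have e3 : ∑ y', v y * (a (val (Sum.inr y)).1 (val (Sum.inr y')).1 * v y') =
          ∑ y', v y * a (val (Sum.inr y)).1 (val (Sum.inr y')).1 * v y' :=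
        Finset.sum_congr rfl fun y' _ => by ring
      rw [Matrix.mulVec, dotProduct, hrow, mul_sub, Finset.mul_sum, e3]
      ring
    have hvv : v ⬝ᵥ v = ∑ y, v y ^ 2 := by
      rw [dotProduct]; exact Finset.sum_congr rfl fun y _ => by ring
    rw [hexp, hvv]
    linarith
  -- invertibility of the head matrices from the left inverses
  letI : Invertible (hd x₁) := invertibleOfLeftInverse _ _ hN₁
  letI : Invertible (hd x₂) := invertibleOfLeftInverse _ _ hN₂
  have hinv₁ : ⅟(hd x₁) = N₁ := by
    rw [Matrix.invOf_eq_nonsing_inv]; exact Matrix.inv_eq_left_inv hN₁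
  have hinv₂ : ⅟(hd x₂) = N₂ := by
    rw [Matrix.invOf_eq_nonsing_inv]; exact Matrix.inv_eq_left_inv hN₂
  -- shell forms in the chain's shape
  have hww : ∀ w : ↥P → ℝ, w ⬝ᵥ w = ∑ i, w i ^ 2 := fun w => by
    rw [dotProduct]; exact Finset.sum_congr rfl fun i _ => by ring
  have hsplit : ∀ (x : ℝ) (w : ↥P → ℝ), ∑ i : ↥P, (x - ℓ i.1 - s) * w i ^ 2 =
      ∑ i : ↥P, (x - ℓ (val (Sum.inr (Sum.inl i))).1) * w i ^ 2 - s * ∑ i, w i ^ 2 := by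
    intro x w
    rw [Finset.mul_sum, ← Finset.sum_sub_distrib]
    exact Finset.sum_congr rfl fun i _ => by rw [hval2]; ring
  have hX₁' : ∀ w : ↥P → ℝ, μ₁ * (w ⬝ᵥ w) ≤
      ∑ i : ↥P, (x₁ - ℓ (val (Sum.inr (Sum.inl i))).1) * w i ^ 2 - s * (w ⬝ᵥ w) -
        w ⬝ᵥ ((C' * ⅟(hd x₁) * B') *ᵥ w) := by
    intro w; rw [hww, hinv₁, ← hsplit]; exact hX₁ w
  have hX₂' : ∀ w : ↥P → ℝ, μ₂ * (w ⬝ᵥ w) ≤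
      ∑ i : ↥P, (x₂ - ℓ (val (Sum.inr (Sum.inl i))).1) * w i ^ 2 - s * (w ⬝ᵥ w) -
        w ⬝ᵥ ((C' * ⅟(hd x₂) * B') *ᵥ w) := by
    intro w; rw [hww, hinv₂, ← hsplit]; exact hX₂ w
  -- tail numbers
  have hq₁' : ∀ k : ↥Q, μ₁ ≤ (x₁ - ℓ (val (Sum.inr (Sum.inr k))).1) - s := fun k => by
    rw [hval3]; have hk := Finset.mem_sdiff.mp k.2; exact hq₁ k.1 hk.1 hk.2
  have hq₂' : ∀ k : ↥Q, μ₂ ≤ (x₂ - ℓ (val (Sum.inr (Sum.inr k))).1) - s := fun k => by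
    rw [hval3]; have hk := Finset.mem_sdiff.mp k.2; exact hq₂ k.1 hk.1 hk.2
  -- the finite half of Theorem 2 (instab3 g3)
  obtain ⟨x, hx, v, hv0, hLv⟩ :=
    SkewCutSchurCoercivity.exists_eigenvalue_of_certificate L e hlt (hd x₁) (hd x₂) B' B' C' C'
      ((Matrix.reindex e e (x₁ • (1 : Matrix ↥F ↥F ℝ) - L)).toBlocks₂₂)
      ((Matrix.reindex e e (x₂ • (1 : Matrix ↥F ↥F ℝ) - L)).toBlocks₂₂)
      (fun y => x₁ - ℓ (val (Sum.inr y)).1) (fun y => x₂ - ℓ (val (Sum.inr y)).1) s μ₁ μ₂ hμ₁ hμ₂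
      (hL x₁) (hL x₂) (hD x₁) (hD x₂) hX₁' hX₂' hq₁' hq₂' hsign
  refine ⟨x, hx, ?_⟩
  -- repackage the eigenvector as a normalised family on `ι` supported in `F`
  set n2 : ℝ := ∑ y, v y ^ 2 with hn2
  have hn2pos : 0 < n2 := by
    rw [hn2]
    obtain ⟨y, hy⟩ : ∃ y, v y ≠ 0 := by
      by_contra h; push Not at h; exact hv0 (funext h)
    exact lt_of_lt_of_le (by positivity : 0 < v y ^ 2)
      (Finset.single_le_sum (f := fun y => v y ^ 2) (fun _ _ => sq_nonneg _) (Finset.mem_univ y))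
  set r : ℝ := Real.sqrt n2 with hr
  have hrpos : 0 < r := Real.sqrt_pos.mpr hn2pos
  have hr2 : r ^ 2 = n2 := Real.sq_sqrt hn2pos.le
  let c : ι → ℝ := fun i => if h : i ∈ F then v ⟨i, h⟩ / r else 0
  have hcF : ∀ y : ↥F, c y.1 = v y / r := fun y => by simp only [c, dif_pos y.2]
  refine ⟨c, fun i hi => by simp only [c, dif_neg hi], ?_, ?_⟩
  · rw [← Finset.sum_coe_sort F]
    simp_rw [hcF, div_pow]
    rw [← Finset.sum_div, ← hn2, hr2]
    exact div_self hn2pos.ne'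
  · intro i hi
    have hy := congr_fun hLv ⟨i, hi⟩
    rw [Pi.smul_apply, smul_eq_mul, Matrix.mulVec, dotProduct] at hy
    -- `hy : Σ_y' L ⟨i⟩ y' v y' = x v ⟨i⟩`
    have hL' : ∑ y' : ↥F, L ⟨i, hi⟩ y' * v y' = ℓ i * v ⟨i, hi⟩ + ∑ y' : ↥F, a i y'.1 * v y' := by
      simp only [L, Matrix.of_apply, add_mul, Finset.sum_add_distrib, ite_mul, zero_mul]
      rw [Finset.sum_ite_eq Finset.univ (⟨i, hi⟩ : ↥F)]
      simp
    rw [hL'] at hy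
    have hsum : ∑ j ∈ F, a i j * c j = (∑ y' : ↥F, a i y'.1 * v y') / r := by
      rw [← Finset.sum_coe_sort F, Finset.sum_div]
      exact Finset.sum_congr rfl fun y _ => by rw [hcF]; ring
    rw [hsum, hcF ⟨i, hi⟩]
    field_simp
    linarith [hy]


/-! ### The data of the END-TO-END theorems for a family of sections, with the graph bound -/

/-- **SECTION DATA FROM TRANSCRIPTS, for a family of sections.** Under the hypotheses of
`exists_section_eigenvector_of_transcripts` with the tail numbers stated off `S₁` (n-independent), the
BAND/GROWTH data of the chain (symmetric band `nbr` of width `W`, `a = 0` off the band,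
`|a_ij| ≤ K w_j`, `w_j² ≤ 1 + |ℓ_j|`, `ℓ ≤ 0`) and a base point `x₀ ≥ x₂`: for EVERY family of finite
sections `F_n ⊇ S₁` there are `c : ℕ → ι → ℝ`, `xs : ℕ → ℝ` with `xs n ∈ [x₁, x₂]`, `c n` supported in
`F_n` and normalised, the section eigen-equation, and the UNIFORM graph bound
`Σ_{F_n} ((x₀ − ℓ_j) c_j)² ≤ 2(x₀ − x₁)² + 2 W² K² (1 + s − x₁)` — the inputs `c, xs, hxs, heig, hnorm,
hgraph` of the END-TO-END theorems of the X0 chain. -/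
theorem section_data_of_transcripts (a : ι → ι → ℝ) (ℓ : ι → ℝ) (hℓ : ∀ i, ℓ i ≤ 0) (s : ℝ)
    (hA : ∀ (G : Finset ι) (u : ι → ℝ), ∑ i ∈ G, ∑ j ∈ G, u i * a i j * u j ≤ s * ∑ i ∈ G, u i ^ 2)
    (nbr : ι → Finset ι) (hsymm : ∀ i j, j ∈ nbr i ↔ i ∈ nbr j) {W : ℕ} (hW : ∀ i, (nbr i).card ≤ W)
    (ha0 : ∀ i j, j ∉ nbr i → a i j = 0) (wgt : ι → ℝ) (hwℓ : ∀ i, wgt i ^ 2 ≤ 1 + |ℓ i|)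
    {K : ℝ} (ha : ∀ i j, j ∈ nbr i → |a i j| ≤ K * wgt j)
    (H S₁ : Finset ι) (hHS : H ⊆ S₁) (hloc : ∀ i ∈ H, ∀ j ∉ S₁, a i j = 0 ∧ a j i = 0)
    {x₁ x₂ : ℝ} (hlt : x₁ < x₂) (x₀ : ℝ) (hx₀ : x₂ ≤ x₀)
    (N₁ N₂ : Matrix ↥H ↥H ℝ)
    (hN₁ : N₁ * (Matrix.of fun i j : ↥H => (if i = j then x₁ - ℓ j else 0) - a i j) = 1)
    (hN₂ : N₂ * (Matrix.of fun i j : ↥H => (if i = j then x₂ - ℓ j else 0) - a i j) = 1)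
    {μ₁ μ₂ : ℝ} (hμ₁ : 0 < μ₁) (hμ₂ : 0 < μ₂)
    (hX₁ : ∀ w : ↥(S₁ \ H) → ℝ, μ₁ * ∑ i, w i ^ 2 ≤ ∑ i : ↥(S₁ \ H), (x₁ - ℓ i.1 - s) * w i ^ 2 -
      w ⬝ᵥ (((Matrix.of fun (i : ↥(S₁ \ H)) (j : ↥H) => -a i j) * N₁ *
        (Matrix.of fun (i : ↥H) (j : ↥(S₁ \ H)) => -a i j)) *ᵥ w))
    (hX₂ : ∀ w : ↥(S₁ \ H) → ℝ, μ₂ * ∑ i, w i ^ 2 ≤ ∑ i : ↥(S₁ \ H), (x₂ - ℓ i.1 - s) * w i ^ 2 -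
      w ⬝ᵥ (((Matrix.of fun (i : ↥(S₁ \ H)) (j : ↥H) => -a i j) * N₂ *
        (Matrix.of fun (i : ↥H) (j : ↥(S₁ \ H)) => -a i j)) *ᵥ w))
    (hq₁ : ∀ i ∉ S₁, μ₁ ≤ x₁ - ℓ i - s) (hq₂ : ∀ i ∉ S₁, μ₂ ≤ x₂ - ℓ i - s)
    (hsign : (Matrix.of fun i j : ↥H => (if i = j then x₁ - ℓ j else 0) - a i j).det *
      (Matrix.of fun i j : ↥H => (if i = j then x₂ - ℓ j else 0) - a i j).det < 0)
    (Fs : ℕ → Finset ι) (hFs : ∀ n, S₁ ⊆ Fs n) :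
    ∃ (c : ℕ → ι → ℝ) (xs : ℕ → ℝ), (∀ n, xs n ∈ Set.Icc x₁ x₂) ∧ (∀ n, ∀ i ∉ Fs n, c n i = 0) ∧
      (∀ n, ∑ i ∈ Fs n, c n i ^ 2 = 1) ∧
      (∀ n, ∀ i ∈ Fs n, ℓ i * c n i + ∑ j ∈ Fs n, a i j * c n j = xs n * c n i) ∧
      (∀ n, ∑ j ∈ Fs n, ((x₀ - ℓ j) * c n j) ^ 2 ≤
        2 * (x₀ - x₁) ^ 2 + 2 * ((W : ℝ) ^ 2 * K ^ 2) * (1 + (s - x₁))) := by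
  have hsec : ∀ n, ∃ x ∈ Set.Ioo x₁ x₂, ∃ c : ι → ℝ, (∀ i ∉ Fs n, c i = 0) ∧
      ∑ i ∈ Fs n, c i ^ 2 = 1 ∧ ∀ i ∈ Fs n, ℓ i * c i + ∑ j ∈ Fs n, a i j * c j = x * c i :=
    fun n => exists_section_eigenvector_of_transcripts a ℓ s hA H S₁ (Fs n) hHS (hFs n) hloc hlt N₁ N₂
      hN₁ hN₂ hμ₁ hμ₂ hX₁ hX₂ (fun i _ hi => hq₁ i hi) (fun i _ hi => hq₂ i hi) hsign
  choose xs hxs c hcF hnorm heig using hsec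
  refine ⟨c, xs, fun n => Set.Ioo_subset_Icc_self (hxs n), hcF, hnorm, heig, fun n => ?_⟩
  have hg := SkewCutGalerkinSectionGraphBound.graph_bound_of_section_eigen a ℓ hℓ s hA nbr hsymm hW
    ha0 wgt hwℓ ha (Fs n) (c n) (hcF n) (hnorm n) (heig n) x₀
  have h1 : (x₀ - xs n) ^ 2 ≤ (x₀ - x₁) ^ 2 := by
    have := (hxs n).1; have := (hxs n).2
    nlinarith
  have h2 : 2 * ((W : ℝ) ^ 2 * K ^ 2) * (1 + (s - xs n)) ≤ 2 * ((W : ℝ) ^ 2 * K ^ 2) * (1 + (s - x₁)) :=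
    mul_le_mul_of_nonneg_left (by linarith [(hxs n).1]) (by positivity)
  linarith

omit [DecidableEq ι] in
/-- **The same data cast into an `RCLike` field** (the input shape of
`SkewCutGalerkinFromResolventData` / `SkewCutGalerkinRealShell`): real section data give
`𝕜`-valued families with the same eigen-equation, normalisation and graph bound. -/
theorem section_data_cast {𝕜 : Type*} [RCLike 𝕜] (a : ι → ι → ℝ) (ℓ : ι → ℝ) (x₀ : ℝ)
    (Fs : ℕ → Finset ι) (c : ℕ → ι → ℝ) (xs : ℕ → ℝ) {C2 : ℝ}
    (hnorm : ∀ n, ∑ i ∈ Fs n, c n i ^ 2 = 1)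
    (heig : ∀ n, ∀ i ∈ Fs n, ℓ i * c n i + ∑ j ∈ Fs n, a i j * c n j = xs n * c n i)
    (hgraph : ∀ n, ∑ j ∈ Fs n, ((x₀ - ℓ j) * c n j) ^ 2 ≤ C2) :
    (∀ n, ∑ j ∈ Fs n, ‖(c n j : 𝕜)‖ ^ 2 = 1) ∧
      (∀ n, ∀ i ∈ Fs n, (ℓ i : 𝕜) * (c n i : 𝕜) +
        ∑ j ∈ Fs n, (a i j : 𝕜) * (c n j : 𝕜) = (xs n : 𝕜) * (c n i : 𝕜)) ∧
      (∀ n, ∑ j ∈ Fs n, ‖((x₀ : 𝕜) - (ℓ j : 𝕜)) * (c n j : 𝕜)‖ ^ 2 ≤ C2) := by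
  refine ⟨fun n => ?_, fun n i hi => ?_, fun n => ?_⟩
  · rw [← hnorm n]
    exact Finset.sum_congr rfl fun j _ => by rw [RCLike.norm_ofReal, sq_abs]
  · have h := heig n i hi
    have : ((ℓ i * c n i + ∑ j ∈ Fs n, a i j * c n j : ℝ) : 𝕜) = ((xs n * c n i : ℝ) : 𝕜) := by rw [h]
    push_cast at this
    exact this
  · refine (le_of_eq ?_).trans (hgraph n)
    refine Finset.sum_congr rfl fun j _ => ?_
    rw [← RCLike.ofReal_sub, ← RCLike.ofReal_mul, RCLike.norm_ofReal, sq_abs]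

end Summit.NavierStokesRegularity.FluidComputer.SkewCutGalerkinSectionData
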